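import Literature.AlgebraicGeometry.HodgeTheory.PolarizationFormTransportFamily
import Literature.AlgebraicGeometry.HodgeTheory.PolarizationFormScaleClass
import Literature.AlgebraicGeometry.HodgeTheory.HodgeRiemannPolarizabilityProofs
import Literature.AlgebraicGeometry.HodgeTheory.HolomorphicBundleChernCharacterTopDegree
import HarnessLib

/-!
# The polarization forms of the Kähler–rational data of two fibres agree, on the MIDDLE cohomology,
# up to a non-zero scalar under parallel transport

Family `hodge`, layer `Literature/AlgebraicGeometry/HodgeTheory`; proof file (theorems only, no
definition, no named fact). Written by the prover seat `hodge-nonav-prover-Ax` (g11, cell `hodge-nonav`)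
for the programme «GRIFFITHS-SURFACES», brick B5b-geometric.

Let `f : 𝒳 ⟶ S` be cohomologically locally trivial over `U`, `s, t ∈ U` with smooth projective fibres of
dimension `n`, `D_s`, `D_t` Kähler–rational data of the fibres (`KaehlerRationalDatum`; their complex
polarization forms `D.cform hX k` on `Hᵏ(X(ℂ); ℂ)` polarize the Hodge structures of the fibres,
`KaehlerRationalDatum.polarization`), and `K ∈ H²(𝒳(ℂ); ℂ)` a GLOBAL class restricting to the Kähler
class `D_t.Hη` on `X_t` and to a non-zero MULTIPLE `μ · D_s.Hη` on `X_s` (for the data produced by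
`exists_kaehlerRationalDatum_eq_map` from one projective embedding of the total space, the two Kähler
classes are pulled back from classes of the line `H²(ℙᴺ; ℂ)`, hence `K := ε^* c_t` works). Then for
every path class `γ` from `s` to `t` in `U` there is `c ≠ 0` with
**`Q_t(γ_* x, γ_* y) = c · Q_s(x, y)` on the middle cohomology `Hⁿ`**
(`KaehlerRationalDatum.exists_cform_transportFun_eq_mul_middle`): transport intertwines the Lefschetz
data (`polarizationForm_transportFun₂`), the traces on the lines `H²ⁿ` are proportional
(`exists_ne_zero_trace_transportFun_eq_mul`, `finrank_complexBetti_two_mul_eq_one`), and on `Hⁿ` the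
polarization form of `μ · η` is that of `η` (`polarizationForm_smul_class_middle`).

## References

* [VoisinHodgeI2002] C. Voisin, Hodge Theory and Complex Algebraic Geometry I, CUP 2002, §7.1.2, §9.2.1.
* [VoisinHodgeII2003] C. Voisin, Hodge Theory and Complex Algebraic Geometry II, CUP 2003, §3.1.2.
-/

noncomputable section

open CategoryTheory AlgebraicGeometry

namespace Literature.AlgebraicGeometry.HodgeTheory

section HodgeTheory

open Literature.AlgebraicTopology.SingularHomology Literature.Geometry.Kaehler

/-- The polarization form only depends on the class, not on the hard-Lefschetz witness: transport of
`polarizationForm` along an equality of classes. [cite: VoisinHodgeI2002, §6.3.2 and §7.1.2] -/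
private theorem polarizationForm_congr_class {Y : Type} [TopologicalSpace Y] {R : Type} [CommRing R]
    {κ κ' : singularCohomology R R Y 2} (e : κ = κ') {n : ℕ}
    (hL : HasHardLefschetzProperty κ n) (hL' : HasHardLefschetzProperty κ' n)
    (hvan : ∀ m, 2 * n < m → Subsingleton (singularCohomology R R Y m))
    (τ : singularCohomology R R Y (2 * n) →ₗ[R] R) (i : ℕ) :
    polarizationForm κ n hL hvan τ i = polarizationForm κ' n hL' hvan τ i := by
  subst e
  rfl

section Family

variable {𝒳 S : Motives.SchemeOver ℂ} (f : 𝒳 ⟶ S) {U : Set (Motives.ComplexPoints S)}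
  (hU : IsCohomologicallyLocallyTrivialOn f U)

/-- **The complex polarization forms of two fibres agree on the middle cohomology up to a non-zero
scalar under transport** (see the module docstring). [cite: VoisinHodgeI2002, §7.1.2 and §9.2.1]
[cite: VoisinHodgeII2003, §3.1.2] -/
theorem KaehlerRationalDatum.exists_cform_transportFun_eq_mul_middle {n : ℕ} {s t : U}
    (hXs : Motives.IsSmoothProjective n (Motives.fiberOver f s.1))
    (hXt : Motives.IsSmoothProjective n (Motives.fiberOver f t.1))
    (Ds : KaehlerRationalDatum n (Motives.fiberOver f s.1))
    (Dt : KaehlerRationalDatum n (Motives.fiberOver f t.1))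
    (K : complexBetti 𝒳 2) (μ : ℂ) (hμ : μ ≠ 0)
    (hKs : complexBetti.map (Motives.fiberι f s.1) 2 K = μ • Ds.Hη)
    (hKt : complexBetti.map (Motives.fiberι f t.1) 2 K = Dt.Hη)
    (γ : Path.Homotopic.Quotient s t) :
    ∃ c : ℂ, c ≠ 0 ∧ ∀ x y : complexBetti (Motives.fiberOver f s.1) n,
      Dt.cform hXt n (transportFun f n hU γ x) (transportFun f n hU γ y) = c * Ds.cform hXs n x y := by
  -- traces on the top lines are proportional under transport
  have hτs : Ds.cTrace hXs ≠ 0 := by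
    intro h
    have hp := (Ds.cTrace_topClass_pos hXs).1
    rw [h, LinearMap.zero_apply, Complex.zero_re] at hp
    exact lt_irrefl _ hp
  have hτt : Dt.cTrace hXt ≠ 0 := by
    intro h
    have hp := (Dt.cTrace_topClass_pos hXt).1
    rw [h, LinearMap.zero_apply, Complex.zero_re] at hp
    exact lt_irrefl _ hp
  obtain ⟨c, hc0, hc⟩ := exists_ne_zero_trace_transportFun_eq_mul f hU
    (finrank_complexBetti_two_mul_eq_one hXs) γ (Ds.cTrace hXs) hτs (Dt.cTrace hXt) hτt
  refine ⟨c, hc0, fun x y ↦ ?_⟩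
  -- hard Lefschetz for the two restrictions of `K`
  set μu : ℂˣ := Units.mk0 μ hμ with hμu
  have hLs' : HasHardLefschetzProperty (complexBetti.map (Motives.fiberι f s.1) 2 K) n := by
    rw [hKs, show μ = ((μu : ℂˣ) : ℂ) from rfl]
    exact hasHardLefschetzProperty_smul_class Ds.Hη μu (Ds.hLℂ hXs)
  have hLt' : HasHardLefschetzProperty (complexBetti.map (Motives.fiberι f t.1) 2 K) n := by
    rw [hKt]; exact Dt.hLℂ hXt
  -- the two-fibre flatness for `K`
  have hflat := polarizationForm_transportFun₂ f hU K hLs' (subsingleton_of_lt hXs ℂ)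
    hLt' (subsingleton_of_lt hXt ℂ) (Ds.cTrace hXs) (Dt.cTrace hXt) c γ hc x y
  -- rewrite both sides as the data's complex forms
  have ht : polarizationForm (complexBetti.map (Motives.fiberι f t.1) 2 K) n hLt'
      (subsingleton_of_lt hXt ℂ) (Dt.cTrace hXt) n = Dt.cform hXt n :=
    polarizationForm_congr_class hKt hLt' (Dt.hLℂ hXt) _ _ n
  have hs : polarizationForm (complexBetti.map (Motives.fiberι f s.1) 2 K) n hLs'
      (subsingleton_of_lt hXs ℂ) (Ds.cTrace hXs) n = Ds.cform hXs n := by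
    rw [polarizationForm_congr_class hKs hLs' (hasHardLefschetzProperty_smul_class Ds.Hη μu (Ds.hLℂ hXs))
      _ _ n]
    refine LinearMap.ext fun a ↦ LinearMap.ext fun b ↦ ?_
    exact polarizationForm_smul_class_middle Ds.Hη (Ds.hLℂ hXs) (subsingleton_of_lt hXs ℂ)
      μu (Ds.cTrace hXs) a b
  rw [ht, hs] at hflat
  exact hflat

end Family

end HodgeTheory

end Literature.AlgebraicGeometry.HodgeTheory

end
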